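import Mathlib.Tactic
import HarnessLib

/-!
# Kozma–Nitzan's Question 8 — the nested uniform form for GENERAL prefixes of any length (gen 36)

Support file (`--supports stmt-CriticalPhenomena-4575`, closed crux; independent mathematics on Kozma–Nitzan's Question 8,
arXiv:2401.12397 §5.5 p. 36), prover `prim-ineq-gen-6` (gen 36).  No definitions, no named facts, no sorries; standard axioms.
Memo `run/shared/lean/prim/prim-ineq-gen-6/PROOF-RCOSI-G36.md`.

Gen 35 reduced the nested uniform form `UNIF-G′(i)` (flat reduction, …KnQuestion8UnifFlat.lean) to the pure prefix statement
`PRE_i − CR_i ≤ c_deep(λ_i)·BUD_i` and proved it for `i = 1` and for A-perfect prefixes.  Gen 36 proves it for EVERY prefix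
(A- and C-defects, any edge weights, any length `i`) with the constant `3/5`, using only the emissions `t_0 > 0` and `t_i > 0`:
(1) the σ-form `t_j = ω̂_j·σ_j`, `σ_j = B̃_j − D_j − r_j − ℓ_j` (`kPG_sigma`), which turns the level-`i` hypothesis into ONE budget
`D_i + r_i + ℓ_i < B̃_i` shared by the D-, R- and LL-debts of the prefix; (2) the exact expansion of `PRE_i − CR_i` into internal,
lens, normalisation and fuel-creation costs minus gains (`kPG_obs`, the fuel identity `kAP_star_step` of gen 35, `kPG_F7`);
(3) the Chebyshev inequality on the first cluster `u·v ≤ T̃·m` (`kPG_CH_sym`, `kPG_CH_sign`), which bounds the deep v-observer by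
`λ_i` times the both-good mass; (4) aggregate bounds, uniform in `i`, for the four costs (`kPG_F8`, `kPG_F9`, `kPG_logsum_step`,
`kPG_alpha`, `kPG_p0`, `kPG_gIpiece`, `kPG_harmonic_mono`); (5) the linearity of the costs in the three debt shares
(`kPG_harmonic`, `kPG_theta`) which leaves `max(A₁₂, A₃)(λ, α_i, S, x, β̂) ≤ (3/5)·f(λ_i)`, a 5-variable inequality certified by an
exact-rational box partition (lab-g36/cert36, 30 709 boxes).  Exact link checks: lab-g36/h36a_sigma.py, h36b_links.py (0 failures).
[cite: KozmaNitzan2024, Question 8 (§5.5 p. 36)]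
-/

namespace Summit.CriticalPhenomena.PercolationContinuityZ3.Theorems

namespace PocketCert

/-- **σ-form of a prefix emission.**  `t_l = w[κ·v̂·(λαSu − T − r) − (1−κ)λ²m₁û]` equals `w·κ·v̂·σ` with
`σ = B̃ − D − r − ℓ`, `B̃ = λαSu − T̃`, `D = T − T̃`, `ℓ = (1−κ)λ²m₁û/(κ v̂)` (the LL-debt).
[cite: KozmaNitzan2024, Question 8 (§5.5 p. 36)] -/
theorem kPG_sigma (w κ vh uh lam alp S u T Tt r m₁ Bt D ell : ℝ) (hκ : κ ≠ 0) (hvh : vh ≠ 0)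
    (hBt : Bt = lam * alp * S * u - Tt) (hD : D = T - Tt) (hell : ell = (1 - κ) * lam ^ 2 * m₁ * uh / (κ * vh)) :
    w * (κ * vh * (lam * alp * S * u - T - r) - (1 - κ) * lam ^ 2 * m₁ * uh) = w * κ * vh * (Bt - D - r - ell) := by
  subst hBt hD hell
  field_simp
  ring

/-- **Chebyshev symmetrisation identity** behind `u·v ≤ T̃·m` on the first cluster: for two cluster lengths with marks
`(a, c)` and `(a′, c′)`, the symmetrised cross terms of `(C¬A)(A¬C) − (¬A¬C)(AC)` equal `(c − c′)(a′ − a)`.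
[cite: KozmaNitzan2024, Question 8 (§5.5 p. 36)] -/
theorem kPG_CH_sym (a a' c c' : ℝ) :
    c * (1 - a) * (a' * (1 - c')) + c' * (1 - a') * (a * (1 - c))
      - (1 - a) * (1 - c) * (a' * c') - (1 - a') * (1 - c') * (a * c) = (c - c') * (a' - a) := by
  ring

/-- **Chebyshev sign.**  Cluster marks are products, so the longer cluster has `a′ ≤ a`, `c′ ≤ c`; hence the symmetrised
term is `≤ 0`, and summing over pairs of lengths gives `u·v ≤ T̃·m`.
[cite: KozmaNitzan2024, Question 8 (§5.5 p. 36)] -/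
theorem kPG_CH_sign (a a' c c' : ℝ) (ha : a' ≤ a) (hc : c' ≤ c) : (c - c') * (a' - a) ≤ 0 := by
  nlinarith

/-- **CH in ratio form.**  From `u v ≤ T̃ m` (absolute), `B̃ = λ_i u − T̃ > 0` written as `T̃ = (1−β̂)λ_i u`:
`v ≤ (1−β̂)·λ_i·m` (the deep v-observer is at most `λ_i` times the both-good mass).
[cite: KozmaNitzan2024, Question 8 (§5.5 p. 36)] -/
theorem kPG_CH_ratio (u v m Tt lami bh : ℝ) (hu : 0 < u) (hCH : u * v ≤ Tt * m) (hTt : Tt = (1 - bh) * lami * u) :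
    v ≤ (1 - bh) * lami * m := by
  subst hTt
  nlinarith

/-- **Observer bookkeeping (one level).**  With `κ_j·C̃ = κ` (the C-chain below level `j`) the deep-v part of level `j`'s
emission minus its perfect-prefix share is `κ·v·[C̃·B − B·p_j/p_i] = κ·v·B·[(p_i − p_j) − (1 − C̃)·p_i]/p_i`:
a normalisation cost `D_{j,i} = p_i − p_j ≥ 0` and a lens GAIN `(1−C̃)p_i`.
[cite: KozmaNitzan2024, Question 8 (§5.5 p. 36)] -/
theorem kPG_obs (κ v B Ct pj pi : ℝ) (hpi : pi ≠ 0) :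
    κ * v * (Ct * B - B * pj / pi) = κ * v * B * ((pi - pj) - (1 - Ct) * pi) / pi := by
  field_simp
  ring

/-- **Transported fuel bound (F7).**  From the iterated fuel identity `α̃·B̃_j = C̃·B − 𝒬 + 𝒫^±` with `𝒬 ≥ 0`, `𝒫^± ≤ 𝒫⁺`,
`σ_j ≤ B̃_j`, `κ_j·C̃ = κ`, `0 ≤ κ_j ≤ 1`, `0 ≤ 𝒫⁺`:  `α̃·κ_j·σ_j ≤ κ·B + 𝒫⁺`.
[cite: KozmaNitzan2024, Question 8 (§5.5 p. 36)] -/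
theorem kPG_F7 (alt Bj Ct B Qc Ps Pp sig κj κ : ℝ) (halt : 0 ≤ alt) (hid : alt * Bj = Ct * B - Qc + Ps)
    (hQ : 0 ≤ Qc) (hPs : Ps ≤ Pp) (hPp : 0 ≤ Pp) (hsig : sig ≤ Bj) (hκj0 : 0 ≤ κj) (hκj1 : κj ≤ 1)
    (hchain : κj * Ct = κ) :
    alt * κj * sig ≤ κ * B + Pp := by
  have h1 : alt * κj * sig ≤ alt * κj * Bj := by
    have : 0 ≤ alt * κj := by positivity
    nlinarith
  have h2 : alt * κj * Bj = κj * (Ct * B - Qc + Ps) := by rw [← hid]; ring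
  have h3 : κj * (Ct * B - Qc + Ps) = κ * B - κj * Qc + κj * Ps := by rw [← hchain]; ring
  nlinarith [mul_nonneg hκj0 hQ, mul_le_mul_of_nonneg_left hPs hκj0]

/-- **Fuel-creation rate (F8).**  Per unit A-defect at `b_{j′}`: `A·P = T̃ − A s v′ + L·m` (`m = A C m̃`), so for the transport
factor `0 ≤ α̃ ≤ 1` with `α̃·L ≤ L′` (`= λ·S_[2,j′]`) and `T̃, m, A s v′ ≥ 0`:  `α̃·(A·P) ≤ T̃ + L′·m`.
[cite: KozmaNitzan2024, Question 8 (§5.5 p. 36)] -/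
theorem kPG_F8 (alt L Lp Tt Asv m AP : ℝ) (halt0 : 0 ≤ alt) (halt1 : alt ≤ 1) (hL : alt * L ≤ Lp)
    (hTt : 0 ≤ Tt) (hv : 0 ≤ Asv) (hm : 0 ≤ m) (hAP : AP = Tt - Asv + L * m) :
    alt * AP ≤ Tt + Lp * m := by
  subst hAP
  nlinarith [mul_nonneg halt0 hv, mul_nonneg (sub_nonneg.mpr halt1) hTt, mul_le_mul_of_nonneg_right hL hm]

/-- **Both-good mass along an open stretch (F9, induction step).**  `m_j ≤ m̃_j = (1−s)p_j + s·m_{j+1}`, `p_j ≤ p`, and the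
induction hypothesis `m_{j+1} ≤ (1−σ)p + σ m` (σ = S_[j+2,i+1]) give `m_j ≤ (1 − sσ)p + sσ·m`.
[cite: KozmaNitzan2024, Question 8 (§5.5 p. 36)] -/
theorem kPG_F9 (mj mj1 s σ pj p m : ℝ) (hs0 : 0 ≤ s) (hs1 : s ≤ 1) (hmt : mj ≤ (1 - s) * pj + s * mj1) (hpj : pj ≤ p)
    (hind : mj1 ≤ (1 - σ) * p + σ * m) :
    mj ≤ (1 - s * σ) * p + s * σ * m := by
  nlinarith [mul_le_mul_of_nonneg_left hind hs0, mul_le_mul_of_nonneg_left hpj (sub_nonneg.mpr hs1)]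

/-- **Cumulative defect sums (F10, induction step).**  If `κ′(1 + s′) ≤ 1` (product of `1 − c` over the vertices so far against
the sum of their defects) then adding a vertex with defect `c ≥ 0`:  `κ′(1−c)(1 + s′ + c) ≤ 1`.  Hence
`Σ_j c_j ≤ (1 − κ_i)/κ_i` and likewise `Σ_j a_j ≤ (1 − α_i)/α_i = (4/3)·r_i`.
[cite: KozmaNitzan2024, Question 8 (§5.5 p. 36)] -/
theorem kPG_logsum_step (κ' s' c : ℝ) (hκ : 0 ≤ κ') (hs : 0 ≤ s') (hc0 : 0 ≤ c)
    (hind : κ' * (1 + s') ≤ 1) : κ' * (1 - c) * (1 + s' + c) ≤ 1 := by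
  have e : κ' * (1 - c) * (1 + s' + c) = κ' * (1 + s') - κ' * c * (s' + c) := by ring
  rw [e]
  nlinarith [mul_nonneg (mul_nonneg hκ hc0) (add_nonneg hs hc0)]

/-- **The prefix A-product is at least 9/16.**  `r_i = ¾(1−α)/α < B̃_i ≤ λ_i ≤ α` gives `¾(1−α) < α²`, hence `α > 9/16`.
[cite: KozmaNitzan2024, Question 8 (§5.5 p. 36)] -/
theorem kPG_alpha (α : ℝ) (hα : 0 < α) (h : 3 / 4 * (1 - α) < α ^ 2) : 9 / 16 < α := by
  nlinarith

/-- **Root mass under `t_0 > 0`.**  `T < λ u₁`, `u₁ ≤ p₀ = 1 − T`, `λ ≥ 0` give `p₀(1+λ) > 1`.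
[cite: KozmaNitzan2024, Question 8 (§5.5 p. 36)] -/
theorem kPG_p0 (T lam u₁ : ℝ) (hlam : 0 ≤ lam) (hT : T < lam * u₁) (hu : u₁ ≤ 1 - T) : 1 < (1 - T) * (1 + lam) := by
  nlinarith [mul_le_mul_of_nonneg_left hu hlam]

/-- **Harmonic combination of the two C-defect constraints.**  `ε_C ≤ θ_C·E₁` (LL-debt) and `ε_C ≤ θ_D·E₂` (D-debt) with
`E₁, E₂ > 0` give `ε_C·(E₁ + E₂) ≤ (θ_C + θ_D)·E₁·E₂`, i.e. `ε_C ≤ (θ_C+θ_D)·E₁E₂/(E₁+E₂)`.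
[cite: KozmaNitzan2024, Question 8 (§5.5 p. 36)] -/
theorem kPG_harmonic (ε θC θD E₁ E₂ : ℝ) (hE1 : 0 < E₁) (hE2 : 0 < E₂) (h1 : ε ≤ θC * E₁) (h2 : ε ≤ θD * E₂) :
    ε * (E₁ + E₂) ≤ (θC + θD) * (E₁ * E₂) := by
  nlinarith [mul_le_mul_of_nonneg_right h1 hE2.le, mul_le_mul_of_nonneg_right h2 hE1.le]

/-- **Monotonicity of the harmonic combination** (used to evaluate `E* = E₁E₂/(E₁+E₂)` at upper bounds of `E₁`, `E₂`).
[cite: KozmaNitzan2024, Question 8 (§5.5 p. 36)] -/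
theorem kPG_harmonic_mono (a b a' b' : ℝ) (ha : 0 < a) (hb : 0 < b) (haa : a ≤ a') (hbb : b ≤ b') :
    a * b / (a + b) ≤ a' * b' / (a' + b') := by
  have ha' : 0 < a' := lt_of_lt_of_le ha haa
  have hb' : 0 < b' := lt_of_lt_of_le hb hbb
  rw [div_le_div_iff₀ (by positivity) (by positivity)]
  nlinarith [mul_nonneg (mul_nonneg ha.le ha'.le) (sub_nonneg.mpr hbb),
    mul_nonneg (mul_nonneg hb.le hb'.le) (sub_nonneg.mpr haa)]

/-- **Linearity in the debt shares.**  The costs are `θ̄·X + (1−θ̄)·Y` with `θ̄ = θ_C + θ_D ∈ [0,1]`, hence `≤ max X Y`.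
[cite: KozmaNitzan2024, Question 8 (§5.5 p. 36)] -/
theorem kPG_theta (θ X Y : ℝ) (h0 : 0 ≤ θ) (h1 : θ ≤ 1) : θ * X + (1 - θ) * Y ≤ max X Y := by
  have hX : X ≤ max X Y := le_max_left X Y
  have hY : Y ≤ max X Y := le_max_right X Y
  nlinarith [mul_le_mul_of_nonneg_left hX h0, mul_le_mul_of_nonneg_left hY (sub_nonneg.mpr h1)]

/-- **λ cancels in the LL-constraint at the CH vertex.**  With `y = (1−β̂)·l·z̄` and `l = λ·α·S`:
`β̂·S·y/(λ·Dn) = β̂(1−β̂)·α·S²·z̄/Dn` (no singularity at `λ → 0`).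
[cite: KozmaNitzan2024, Question 8 (§5.5 p. 36)] -/
theorem kPG_E1cancel (bh S y lam alp zb Dn l : ℝ) (hlam : lam ≠ 0) (hDn : Dn ≠ 0) (hl : l = lam * alp * S)
    (hy : y = (1 - bh) * l * zb) : bh * S * y / (lam * Dn) = bh * (1 - bh) * alp * S ^ 2 * zb / Dn := by
  subst hl hy
  field_simp

/-- **Piecewise bound used by the box certificate** for the inner maxima over `σ′ ∈ [σ_a, σ_b] ⊂ (0,1]`:
`(1 − q/σ′)(1 − σ′) ≤ (1 − q/σ_b)(1 − σ_a)` when `0 ≤ q ≤ σ_a` (both factors nonnegative and monotone).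
[cite: KozmaNitzan2024, Question 8 (§5.5 p. 36)] -/
theorem kPG_gIpiece (q σ σa σb : ℝ) (hσa : 0 < σa) (hq0 : 0 ≤ q) (hq : q ≤ σa) (h1 : σa ≤ σ) (h2 : σ ≤ σb)
    (hσb1 : σb ≤ 1) : (1 - q / σ) * (1 - σ) ≤ (1 - q / σb) * (1 - σa) := by
  have hσ : 0 < σ := lt_of_lt_of_le hσa h1
  have hσb : 0 < σb := lt_of_lt_of_le hσ h2
  have f1 : 1 - q / σ ≤ 1 - q / σb := by
    have : q / σb ≤ q / σ := div_le_div_of_nonneg_left hq0 hσ h2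
    linarith
  have f1nn : 0 ≤ 1 - q / σ := by
    rw [sub_nonneg, div_le_one hσ]; linarith
  have f2 : 1 - σ ≤ 1 - σa := by linarith
  have f2nn : 0 ≤ 1 - σ := by linarith
  calc (1 - q / σ) * (1 - σ) ≤ (1 - q / σb) * (1 - σ) := mul_le_mul_of_nonneg_right f1 f2nn
    _ ≤ (1 - q / σb) * (1 - σa) := by
        apply mul_le_mul_of_nonneg_left f2
        rw [sub_nonneg, div_le_one hσb]; linarith

/-- **LL-constant audit, scalar facts.**  The root-0 LL constant available for a block with `k₁ ≥ 2` positive depths is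
`(3 + S_{k₁})/(4 s₁²) ≥ (3 + S)/4` with `S = S_[2,i+1]` (gen 33 §3); and `(3+S)/4 ≥ 3/4`, `(3+S)/4 ≥ S` for `S ∈ [0,1]`.
The prefix lemma tolerates any LL constant `≥ 3/4` (certificate cert36_ll); the flat-reduction slack needs `≥ S` (next kernel).
[cite: KozmaNitzan2024, Question 8 (§5.5 p. 36)] -/
theorem kPG_llconst (S s₁ : ℝ) (hS0 : 0 ≤ S) (hS1 : S ≤ 1) (hs0 : 0 < s₁) (hs1 : s₁ ≤ 1) :
    (3 + S) / 4 ≤ (3 + s₁ * S) / (4 * s₁ ^ 2) ∧ 3 / 4 ≤ (3 + S) / 4 ∧ S ≤ (3 + S) / 4 := by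
  refine ⟨?_, by linarith, by linarith⟩
  rw [div_le_div_iff₀ (by norm_num) (by positivity)]
  nlinarith [mul_nonneg hS0 (sub_nonneg.mpr hs1), mul_nonneg (sub_nonneg.mpr hs1) hs0.le,
    mul_nonneg (mul_nonneg hS0 hs0.le) (sub_nonneg.mpr hs1), sq_nonneg s₁]

/-- **LL-constant audit: the flat-reduction slack stays nonnegative.**  With the root-0 LL constant `c₀ ≥ S` (`S = S_[2,i+1]`),
the top both-good mass bound `m₁ ≥ ακ((1−S)p₀ + S m)` (F2), `κ_l = κ·κ̃_l`, `λ_i = λαS`, the LL part of `SL_l` is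
`c₀(1−κ_l)λ²m₁ − κ(1−κ̃_l)λ_i²m ≥ 0`: the deficient root-0 LL kill still dominates the re-rooted block's LL kill.
[cite: KozmaNitzan2024, Question 8 (§5.5 p. 36)] -/
theorem kPG_SL_llaudit (c₀ S alp kap kapt m₁ m p₀ lam : ℝ) (hc : S ≤ c₀) (hS0 : 0 ≤ S) (halp0 : 0 ≤ alp)
    (halp1 : alp ≤ 1) (hkap0 : 0 ≤ kap) (hkap1 : kap ≤ 1) (hkt0 : 0 ≤ kapt) (hkt1 : kapt ≤ 1) (hm : 0 ≤ m) (hp0 : 0 ≤ p₀)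
    (hm1 : alp * kap * ((1 - S) * p₀ + S * m) ≤ m₁) (hS1 : S ≤ 1) :
    kap * (1 - kapt) * (lam * alp * S) ^ 2 * m ≤ c₀ * (1 - kap * kapt) * lam ^ 2 * m₁ := by
  have hc0 : 0 ≤ c₀ := le_trans hS0 hc
  have h1 : 1 - kapt ≤ 1 - kap * kapt := by nlinarith [mul_nonneg (sub_nonneg.mpr hkap1) hkt0]
  have h1nn : 0 ≤ 1 - kapt := sub_nonneg.mpr hkt1
  -- m₁ ≥ alp kap S m
  have hm1' : alp * kap * S * m ≤ m₁ := by nlinarith [mul_nonneg (mul_nonneg halp0 hkap0) (mul_nonneg (sub_nonneg.mpr hS1) hp0)]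
  have hm1nn : 0 ≤ m₁ := le_trans (by positivity) hm1'
  -- chain: kap(1-kapt)(lam alp S)^2 m = [alp S] * (1-kapt) * lam^2 * (alp kap S m) <= 1 * c₀ * (1 - kap kapt) * lam^2 * m₁
  have e : kap * (1 - kapt) * (lam * alp * S) ^ 2 * m = (alp * S) * ((1 - kapt) * lam ^ 2 * (alp * kap * S * m)) := by ring
  rw [e]
  have hAS : alp * S ≤ c₀ := by nlinarith [mul_le_mul halp1 hc hS0 (by norm_num : (0:ℝ) ≤ 1)]
  have hin : (1 - kapt) * lam ^ 2 * (alp * kap * S * m) ≤ (1 - kap * kapt) * lam ^ 2 * m₁ := by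
    apply mul_le_mul (mul_le_mul_of_nonneg_right h1 (sq_nonneg lam)) hm1' (by positivity)
    exact mul_nonneg (le_trans h1nn h1) (sq_nonneg lam)
  have hinn : 0 ≤ (1 - kapt) * lam ^ 2 * (alp * kap * S * m) := by positivity
  calc (alp * S) * ((1 - kapt) * lam ^ 2 * (alp * kap * S * m))
      ≤ c₀ * ((1 - kapt) * lam ^ 2 * (alp * kap * S * m)) := mul_le_mul_of_nonneg_right hAS hinn
    _ ≤ c₀ * ((1 - kap * kapt) * lam ^ 2 * m₁) := mul_le_mul_of_nonneg_left hin hc0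
    _ = c₀ * (1 - kap * kapt) * lam ^ 2 * m₁ := by ring

end PocketCert

end Summit.CriticalPhenomena.PercolationContinuityZ3.Theorems
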